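import Summits.NavierStokesRegularity.FunctionalMining.StretchingLaminateQuartic
import Summits.NavierStokesRegularity.FunctionalMining.StretchingLaminateSexticCert
import Mathlib.Algebra.Order.BigOperators.Ring.Finset
import Mathlib.Algebra.BigOperators.Fin
import Mathlib.LinearAlgebra.Matrix.Notation
import Mathlib.Tactic.Linarith
import Mathlib.Tactic.Positivity
import HarnessLib

/-!
# FunctionalMining — K1-Q1 laminates: the SEXTIC MOMENT BOUND (T6) along lamination trees and the dual assembly `LeafClaim6 θ a b c → RatioBound θ` (dict seat, staged)

search for candidate a priori estimates; no regularity claim.  Static rational/real algebra on finite lamination trees; nothing about Navier–Stokes solutions; no literature claim.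

The (T6) analogue of `StretchingLaminateQuartic` (ap).  Bank g5's THEOREM L-CAP v2 (`K1Q1-LAMINATE-CAP.md` §2–3,
hand variant (T6)): `U₆ = |S|⁶ + (10|S|⁴ + 450|S|²M² + 1178M⁴)(M² − |ω|²)` is Λ-concave along div-free rank-one
segments inside `{|ω|² ≤ M²}`, hence `Σ_L W_L U₆(G_L) ≤ U₆(0) = 1178 M⁶` down every valid tree with `M²(𝒯) ≤ M²`,
and the dual certificate with a sextic moment multiplier `c₆ ≥ 0` bounds the laminate ratio.

* **Layer identities and Cauchy–Schwarz (VERBATIM from bank g5's kernel scratch `pub-nsfunc-bank/LAMCAP-TREE.scratch.lean` v5 (2026-08-20T09:39:50Z, sha256[:16] 9ff62d392164e026, `import Mathlib`, farm rc 0 / 0 sorry per bank; authorship bank g5), Part B, namespace `Grad`)**: `Grad.frob`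
  (`⟨S, S_B⟩_F`), `Grad.vdot` (`ω·w`), `vortSq_layer`, `sSq_layer`, `vdot_sq_le : (ω·w)² ≤ |ω|²|w|²`,
  `two_frob_sq_le : c·n = 0 → 2⟨S,S_B⟩² ≤ |S|²|w|²` (Cauchy–Schwarz in `ℚ^(3×3)`, `Finset.sum_mul_sq_le_sq_mul_sq`).
* **dict's part**: `Grad.sexticU M₂ G` (the supersolution over `ℚ`, `M₂ = M²`), the per-node two-point inequality
  `sexticU_split` (cast to `ℝ` with `M = √M₂`, then (at)'s `chord_T6 bracket6_holds` at
  `q = |S|², m = |ω|², α = ⟨S,S_B⟩, β = ω·w, γ = |w|²`), `Tree.leafSum_sexticU_le` (Jensen down the tree, pattern of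
  (ap) `leafSum_quarticU_le`; the node's own `|ω|² ≤ M₂` is `Tree.vortSq_le_vortSupFrom`),
  **`Tree.sextic_moment : M²(𝒯) ≤ M₂ → Σ_L W_L U₆(G_L) ≤ 1178 M₂³`**, the typed node `LeafClaim6 θ a b c`
  (homogeneous per-leaf dual inequality with the sextic term `(c/M³)(U₆(G) − 1178M⁶)`), `Tree.leafClaim6_sum`, and
  **`ratioBound_of_leafClaim6 : LeafClaim6 θ a b c → 0 ≤ c → RatioBound θ`** (isometry (I1), laminate Betchov (I2)
  of (an), sextic moment (T6), `Σ W = 1`; degenerate `M(𝒯) = 0` by the Hölder bound of (ad)) — verbatim the proof of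
  (ap) `ratioBound_of_leafClaim` with `24M⁴ ↦ 1178M⁶`, `c/M ↦ c/M³`.
The eigenframe bridge `PolyClaim6 → LeafClaim6` and the binding of census-1 (A)'s kernel claim V2 (`C_lam ≤ 1.021188`)
are (av) `StretchingLaminateSexticEigen` and (aw) `StretchingLaminateCapFinal6`.
search for candidate a priori estimates; no regularity claim.
-/


namespace Summit.NavierStokesRegularity.FunctionalMining

open Literature.Analysis Literature.Analysis.FunctionSpaces Literature.Analysis.FunctionSpaces.Torus
open Literature.Analysis.FluidPDE Literature.Analysis.FluidPDE.Torus

namespace Laminate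

namespace Split

/-- `0 ≤ |w|²`. [ours; bookkeeping] -/
theorem wSq_nonneg (s : Split) : 0 ≤ s.wSq := by
  simp only [wSq]; nlinarith [mul_self_nonneg s.w0, mul_self_nonneg s.w1, mul_self_nonneg s.w2]

end Split

namespace Grad

/-- `0 ≤ |S|²`. [ours; bookkeeping] -/
theorem sSq_nonneg (G : Grad) : 0 ≤ G.sSq := by
  simp only [sSq]
  nlinarith [mul_self_nonneg G.g00, mul_self_nonneg G.g11, mul_self_nonneg G.g22, mul_self_nonneg (G.g01 + G.g10),
    mul_self_nonneg (G.g02 + G.g20), mul_self_nonneg (G.g12 + G.g21)]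

/-! ## Layer identities for `|S|²`, `|ω|²` and the two Cauchy–Schwarz inputs of the bracket (bank g5, Part B, verbatim) -/

/-- `⟨S_G, S_B⟩_F = Σᵢⱼ Sᵢⱼ cᵢ nⱼ` (the `t`-derivative of `|S|²/2` along the layer). -/
def frob (G : Grad) (s : Split) : ℚ := (G.g00 + G.g00) / 2 * s.c0 * s.n0 + (G.g01 + G.g10) / 2 * s.c0 * s.n1 + (G.g02 + G.g20) / 2 * s.c0 * s.n2 + (G.g10 + G.g01) / 2 * s.c1 * s.n0 + (G.g11 + G.g11) / 2 * s.c1 * s.n1 + (G.g12 + G.g21) / 2 * s.c1 * s.n2 + (G.g20 + G.g02) / 2 * s.c2 * s.n0 + (G.g21 + G.g12) / 2 * s.c2 * s.n1 + (G.g22 + G.g22) / 2 * s.c2 * s.n2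

/-- `ω(G) · w` (the `t`-derivative of `|ω|²/2` along the layer). -/
def vdot (G : Grad) (s : Split) : ℚ := G.vort0 * s.w0 + G.vort1 * s.w1 + G.vort2 * s.w2

/-- `|ω(G + tB)|² = |ω|² + 2t ω·w + t²|w|²`. -/
theorem vortSq_layer (G : Grad) (t : ℚ) (s : Split) :
    (G.layer t s).vortSq = G.vortSq + 2 * t * G.vdot s + t ^ 2 * s.wSq := by
  simp only [vortSq, vort0_layer, vort1_layer, vort2_layer, vdot, Split.wSq]; ring

/-- `|S(G + tB)|² = |S|² + 2t⟨S,S_B⟩ + t²(|w|²/2 + (c·n)²)`. -/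
theorem sSq_layer (G : Grad) (t : ℚ) (s : Split) :
    (G.layer t s).sSq = G.sSq + 2 * t * G.frob s + t ^ 2 * (s.wSq / 2) + t ^ 2 * s.dot ^ 2 := by
  simp only [sSq, layer, frob, Split.wSq, Split.w0, Split.w1, Split.w2, Split.dot]; ring

/-- Cauchy–Schwarz for `ω·w`: `(ω·w)² ≤ |ω|²|w|²`. -/
theorem vdot_sq_le (G : Grad) (s : Split) : G.vdot s ^ 2 ≤ G.vortSq * s.wSq := by
  simp only [vdot, vortSq, Split.wSq]
  nlinarith [sq_nonneg (G.vort0 * s.w1 - G.vort1 * s.w0), sq_nonneg (G.vort0 * s.w2 - G.vort2 * s.w0),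
    sq_nonneg (G.vort1 * s.w2 - G.vort2 * s.w1)]

/-- Cauchy–Schwarz for `⟨S, S_B⟩_F`: `2⟨S,S_B⟩² ≤ |S|²·|w|²` for a div-free split (`|S_B|² = |w|²/2`). -/
theorem two_frob_sq_le (G : Grad) (s : Split) (h : s.dot = 0) : 2 * G.frob s ^ 2 ≤ G.sSq * s.wSq := by
  -- Cauchy–Schwarz in `ℚ^(3×3)` between `S` and `S_B = (c⊗n + n⊗c)/2`, as in the tree's `quadForm_sq_le_two_thirds`
  set S : Fin 3 → Fin 3 → ℚ :=
    ![![G.g00, (G.g01 + G.g10) / 2, (G.g02 + G.g20) / 2],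
      ![(G.g01 + G.g10) / 2, G.g11, (G.g12 + G.g21) / 2],
      ![(G.g02 + G.g20) / 2, (G.g12 + G.g21) / 2, G.g22]] with hS
  set SB : Fin 3 → Fin 3 → ℚ :=
    ![![s.c0 * s.n0, (s.c0 * s.n1 + s.c1 * s.n0) / 2, (s.c0 * s.n2 + s.c2 * s.n0) / 2],
      ![(s.c0 * s.n1 + s.c1 * s.n0) / 2, s.c1 * s.n1, (s.c1 * s.n2 + s.c2 * s.n1) / 2],
      ![(s.c0 * s.n2 + s.c2 * s.n0) / 2, (s.c1 * s.n2 + s.c2 * s.n1) / 2, s.c2 * s.n2]] with hSB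
  have hCS := Finset.sum_mul_sq_le_sq_mul_sq (Finset.univ : Finset (Fin 3 × Fin 3))
    (fun p => S p.1 p.2) (fun p => SB p.1 p.2)
  have h1 : ∑ p : Fin 3 × Fin 3, S p.1 p.2 * SB p.1 p.2 = G.frob s := by
    rw [Fintype.sum_prod_type]
    simp only [hS, hSB, Fin.sum_univ_three, Fin.isValue]
    simp
    simp only [frob]
    ring
  have h2 : ∑ p : Fin 3 × Fin 3, S p.1 p.2 ^ 2 = G.sSq := by
    rw [Fintype.sum_prod_type]
    simp only [hS, Fin.sum_univ_three, Fin.isValue]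
    simp
    simp only [sSq]
    ring
  have h3 : ∑ p : Fin 3 × Fin 3, SB p.1 p.2 ^ 2 = s.ampSq / 2 + s.dot ^ 2 / 2 := by
    rw [Fintype.sum_prod_type]
    simp only [hSB, Fin.sum_univ_three, Fin.isValue]
    simp
    simp only [Split.ampSq, Split.dot]
    ring
  rw [h1, h2, h3, h] at hCS
  have hw : s.wSq = s.ampSq - s.dot * s.dot := Split.wSq_eq s
  rw [h] at hw
  have hprod : G.sSq * s.wSq = G.sSq * s.ampSq := by rw [hw]; ring
  nlinarith [hCS, hprod]

/-! ## The sextic supersolution along the tree (dict) -/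

/-- **The sextic supersolution** `U₆(G) = |S|⁶ + (10|S|⁴ + 450|S|²M₂ + 1178M₂²)(M₂ − |ω|²)` (`M₂ = M²`). [ours; bookkeeping] -/
def sexticU (M2 : ℚ) (G : Grad) : ℚ :=
  G.sSq ^ 3 + (10 * G.sSq ^ 2 + 450 * G.sSq * M2 + 1178 * M2 ^ 2) * (M2 - G.vortSq)

/-- `U₆(0) = 1178 M₂³`. [ours; bookkeeping] -/
theorem sexticU_zero (M2 : ℚ) : Grad.zero.sexticU M2 = 1178 * M2 ^ 3 := by
  have hs : Grad.zero.sSq = 0 := by simp [zero, sSq]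
  have hv : Grad.zero.vortSq = 0 := by simp [zero, vortSq, vort0, vort1, vort2]
  simp only [sexticU, hs, hv]; ring

/-- **Per-node two-point inequality for `U₆`** on a div-free split with the node and both children in `{|ω|² ≤ M₂}`:
`λ U₆(G₊) + (1−λ) U₆(G₋) ≤ U₆(G)` — (at)'s `chord_T6 bracket6_holds` at the node's scalars, `M = √M₂`. [ours; elementary] -/
theorem sexticU_split (G : Grad) (s : Split) (hdot : s.dot = 0) (h0 : 0 ≤ s.lam) (h1 : s.lam ≤ 1)
    {M2 : ℚ} (hG : G.vortSq ≤ M2) (hp : (G.layer (1 - s.lam) s).vortSq ≤ M2)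
    (hm : (G.layer (-s.lam) s).vortSq ≤ M2) :
    s.lam * (G.layer (1 - s.lam) s).sexticU M2 + (1 - s.lam) * (G.layer (-s.lam) s).sexticU M2
      ≤ G.sexticU M2 := by
  have hM2nn : (0 : ℚ) ≤ M2 := le_trans (vortSq_nonneg G) hG
  have hM2R : (0 : ℝ) ≤ ((M2 : ℚ) : ℝ) := by exact_mod_cast hM2nn
  set M : ℝ := Real.sqrt ((M2 : ℚ) : ℝ) with hMdef
  have hM2 : M ^ 2 = ((M2 : ℚ) : ℝ) := by rw [hMdef, Real.sq_sqrt hM2R]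
  have hM4 : M ^ 4 = ((M2 : ℚ) : ℝ) ^ 2 := by rw [← hM2]; ring
  -- the children's scalars (ℚ)
  have qSp : (G.layer (1 - s.lam) s).sSq = G.sSq + 2 * (1 - s.lam) * G.frob s + (1 - s.lam) ^ 2 * (s.wSq / 2) := by
    rw [sSq_layer, hdot]; ring
  have qSm : (G.layer (-s.lam) s).sSq = G.sSq + 2 * (-s.lam) * G.frob s + (-s.lam) ^ 2 * (s.wSq / 2) := by
    rw [sSq_layer, hdot]; ring
  have qVp : (G.layer (1 - s.lam) s).vortSq = G.vortSq + 2 * (1 - s.lam) * G.vdot s + (1 - s.lam) ^ 2 * s.wSq :=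
    vortSq_layer G (1 - s.lam) s
  have qVm : (G.layer (-s.lam) s).vortSq = G.vortSq + 2 * (-s.lam) * G.vdot s + (-s.lam) ^ 2 * s.wSq :=
    vortSq_layer G (-s.lam) s
  -- the hypotheses of `chord_T6`, in ℝ
  have hq : (0 : ℝ) ≤ ((G.sSq : ℚ) : ℝ) := by exact_mod_cast sSq_nonneg G
  have hmnn : (0 : ℝ) ≤ ((G.vortSq : ℚ) : ℝ) := by exact_mod_cast vortSq_nonneg G
  have hγ : (0 : ℝ) ≤ ((s.wSq : ℚ) : ℝ) := by exact_mod_cast Split.wSq_nonneg s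
  have hcs1 : 2 * ((G.frob s : ℚ) : ℝ) ^ 2 ≤ ((G.sSq : ℚ) : ℝ) * ((s.wSq : ℚ) : ℝ) := by
    exact_mod_cast two_frob_sq_le G s hdot
  have hcs2 : ((G.vdot s : ℚ) : ℝ) ^ 2 ≤ ((G.vortSq : ℚ) : ℝ) * ((s.wSq : ℚ) : ℝ) := by
    exact_mod_cast vdot_sq_le G s
  have h0' : (0 : ℝ) ≤ ((s.lam : ℚ) : ℝ) := by exact_mod_cast h0
  have h1' : ((s.lam : ℚ) : ℝ) ≤ 1 := by exact_mod_cast h1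
  have hm0 : ((G.vortSq : ℚ) : ℝ) ≤ M ^ 2 := by rw [hM2]; exact_mod_cast hG
  have hmp : ((G.vortSq : ℚ) : ℝ) + 2 * ((G.vdot s : ℚ) : ℝ) * (1 - ((s.lam : ℚ) : ℝ))
      + ((s.wSq : ℚ) : ℝ) * (1 - ((s.lam : ℚ) : ℝ)) ^ 2 ≤ M ^ 2 := by
    have hp2 := hp
    rw [qVp] at hp2
    have hp3 : ((G.vortSq + 2 * (1 - s.lam) * G.vdot s + (1 - s.lam) ^ 2 * s.wSq : ℚ) : ℝ) ≤ ((M2 : ℚ) : ℝ) := by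
      exact_mod_cast hp2
    have e : ((G.vortSq : ℚ) : ℝ) + 2 * ((G.vdot s : ℚ) : ℝ) * (1 - ((s.lam : ℚ) : ℝ))
        + ((s.wSq : ℚ) : ℝ) * (1 - ((s.lam : ℚ) : ℝ)) ^ 2
        = ((G.vortSq + 2 * (1 - s.lam) * G.vdot s + (1 - s.lam) ^ 2 * s.wSq : ℚ) : ℝ) := by
      push_cast; ring
    rw [e, hM2]; exact hp3
  have hmm : ((G.vortSq : ℚ) : ℝ) + 2 * ((G.vdot s : ℚ) : ℝ) * (-((s.lam : ℚ) : ℝ))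
      + ((s.wSq : ℚ) : ℝ) * (-((s.lam : ℚ) : ℝ)) ^ 2 ≤ M ^ 2 := by
    have hm2 := hm
    rw [qVm] at hm2
    have hm3 : ((G.vortSq + 2 * (-s.lam) * G.vdot s + (-s.lam) ^ 2 * s.wSq : ℚ) : ℝ) ≤ ((M2 : ℚ) : ℝ) := by
      exact_mod_cast hm2
    have e : ((G.vortSq : ℚ) : ℝ) + 2 * ((G.vdot s : ℚ) : ℝ) * (-((s.lam : ℚ) : ℝ))
        + ((s.wSq : ℚ) : ℝ) * (-((s.lam : ℚ) : ℝ)) ^ 2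
        = ((G.vortSq + 2 * (-s.lam) * G.vdot s + (-s.lam) ^ 2 * s.wSq : ℚ) : ℝ) := by
      push_cast; ring
    rw [e, hM2]; exact hm3
  have key := chord_T6 bracket6_holds ((G.sSq : ℚ) : ℝ) ((G.vortSq : ℚ) : ℝ) ((G.frob s : ℚ) : ℝ)
    ((G.vdot s : ℚ) : ℝ) ((s.wSq : ℚ) : ℝ) M ((s.lam : ℚ) : ℝ) hq hmnn hγ hcs1 hcs2 h0' h1' hmp hmm hm0
  -- identify the three values of `U6line` with the casts of `sexticU`
  have e0 : U6line 10 450 1178 ((G.sSq : ℚ) : ℝ) ((G.vortSq : ℚ) : ℝ) ((G.frob s : ℚ) : ℝ) ((G.vdot s : ℚ) : ℝ)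
      ((s.wSq : ℚ) : ℝ) M 0 = ((G.sexticU M2 : ℚ) : ℝ) := by
    unfold U6line; simp only [sexticU]; push_cast; rw [hM4, hM2]; ring
  have eP : U6line 10 450 1178 ((G.sSq : ℚ) : ℝ) ((G.vortSq : ℚ) : ℝ) ((G.frob s : ℚ) : ℝ) ((G.vdot s : ℚ) : ℝ)
      ((s.wSq : ℚ) : ℝ) M (1 - ((s.lam : ℚ) : ℝ)) = (((G.layer (1 - s.lam) s).sexticU M2 : ℚ) : ℝ) := by
    unfold U6line; simp only [sexticU]; rw [qSp, qVp]; push_cast; rw [hM4, hM2]; ring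
  have eM : U6line 10 450 1178 ((G.sSq : ℚ) : ℝ) ((G.vortSq : ℚ) : ℝ) ((G.frob s : ℚ) : ℝ) ((G.vdot s : ℚ) : ℝ)
      ((s.wSq : ℚ) : ℝ) M (-((s.lam : ℚ) : ℝ)) = (((G.layer (-s.lam) s).sexticU M2 : ℚ) : ℝ) := by
    unfold U6line; simp only [sexticU]; rw [qSm, qVm]; push_cast; rw [hM4, hM2]; ring
  rw [e0, eP, eM] at key
  have keyQ : ((s.lam * (G.layer (1 - s.lam) s).sexticU M2 + (1 - s.lam) * (G.layer (-s.lam) s).sexticU M2 : ℚ) : ℝ)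
      ≤ ((G.sexticU M2 : ℚ) : ℝ) := by
    push_cast; exact key
  exact_mod_cast keyQ

end Grad

namespace Tree

/-- **(T6) along the tree (Jensen for the Λ-concave sextic supersolution).** Below a node in state `G` with weight
`W ≥ 0` on a valid tree whose leaves obey `|ω_L|² ≤ M₂`: `Σ_L W_L U₆(G_L) ≤ W·U₆(G)`. [ours; elementary] -/
theorem leafSum_sexticU_le (M2 : ℚ) (T : Tree) (hT : T.valid = true) :
    ∀ (G : Grad) (W : ℚ), 0 ≤ W → T.vortSupFrom G ≤ M2 →
      T.leafSum (Grad.sexticU M2) G W ≤ W * G.sexticU M2 := by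
  induction T with
  | leaf => intro G W _ _; simp [leafSum]
  | node s p m ihp ihm =>
      intro G W hW hsup
      obtain ⟨h0, h1, hdot, hp, hm⟩ := valid_node hT
      have hc := vortSupFrom_children s p m G
      have hsupP := hc.1.trans hsup
      have hsupM := hc.2.trans hsup
      have hvG : G.vortSq ≤ M2 := (vortSq_le_vortSupFrom (node s p m) hT G).trans hsup
      have hvp : (G.layer (1 - s.lam) s).vortSq ≤ M2 := (vortSq_le_vortSupFrom p hp _).trans hsupP
      have hvm : (G.layer (-s.lam) s).vortSq ≤ M2 := (vortSq_le_vortSupFrom m hm _).trans hsupM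
      have hP := ihp hp (G.layer (1 - s.lam) s) (W * s.lam) (mul_nonneg hW h0.le) hsupP
      have hM := ihm hm (G.layer (-s.lam) s) (W * (1 - s.lam)) (mul_nonneg hW (by linarith)) hsupM
      have hnode := mul_le_mul_of_nonneg_left (Grad.sexticU_split G s hdot h0.le h1.le hvG hvp hvm) hW
      simp only [leafSum]
      nlinarith [hP, hM, hnode]

/-- **(T6) THE SEXTIC MOMENT BOUND**: `Σ_L W_L [ |S_L|⁶ + (10|S_L|⁴ + 450|S_L|²M₂ + 1178M₂²)(M₂ − |ω_L|²) ] ≤ 1178 M₂³`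
for every valid lamination tree with `M²(𝒯) ≤ M₂`; in particular `Σ_L W_L |S_L|⁶ ≤ 1178 M⁶`
(bank THEOREM L-CAP §2, hand variant (T6)). [ours; elementary] -/
theorem sextic_moment (T : Tree) (hT : T.valid = true) {M2 : ℚ} (hsup : T.vortSup ≤ M2) :
    T.leafSum (Grad.sexticU M2) Grad.zero 1 ≤ 1178 * M2 ^ 3 := by
  have h := leafSum_sexticU_le M2 T hT Grad.zero 1 zero_le_one hsup
  rw [Grad.sexticU_zero] at h; linarith

/-- `board`: `Σ W U₆(G_L) = 262 ≤ 1178` (with `M₂ = M²(board) = 1`). [ours; bookkeeping] -/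
theorem board_sextic : board.leafSum (Grad.sexticU 1) Grad.zero 1 ≤ 1178 := by decide +kernel

end Tree

/-! ## The dual assembly with the sextic moment: `LeafClaim6 θ a b c → RatioBound θ` -/

/-- **Typed node (NOT asserted): the pointwise LEAF INEQUALITY of the (T6) dual certificate**, homogeneous form.
For every trace-free rational state `G` and real `M > 0` with `|ω(G)|² ≤ M²`:
`(1 − ¾b)·ωᵀSω ≤ θ·M·|S|² + a·M·(|S|² − ½|ω|²) + b·tr S³ + (c/M³)·(U₆(G) − 1178M⁶)`.
It follows from bank's 2-variable T6 claim (`PolyClaim6`, K1Q1-LAMINATE-CAP §3) by the eigenframe bridge of (av).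
[ours; typed node] -/
def LeafClaim6 (θ a b c : ℝ) : Prop :=
  ∀ (G : Grad) (M : ℝ), 0 < M → G.trace = 0 → (G.vortSq : ℝ) ≤ M ^ 2 →
    (1 - 3 / 4 * b) * (G.stretch : ℝ)
      ≤ θ * M * (G.sSq : ℝ) + a * M * ((G.sSq : ℝ) - (G.vortSq : ℝ) / 2) + b * (G.symCubeTrace : ℝ)
        + c / M ^ 3 * ((G.sSq : ℝ) ^ 3 + (10 * (G.sSq : ℝ) ^ 2 + 450 * (G.sSq : ℝ) * M ^ 2 + 1178 * M ^ 4)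
            * (M ^ 2 - (G.vortSq : ℝ)) - 1178 * M ^ 6)

namespace Tree

/-- **Summing the sextic leaf claim down a valid tree** (pattern of (ap) `leafClaim_sum`). [ours; elementary] -/
theorem leafClaim6_sum {θ a b c : ℝ} (h : LeafClaim6 θ a b c) {M : ℝ} (hM : 0 < M) {V : ℚ}
    (hV : ((V : ℚ) : ℝ) = M ^ 2) (T : Tree) (hT : T.valid = true) :
    ∀ (G : Grad) (W : ℚ), G.trace = 0 → 0 ≤ W → T.vortSupFrom G ≤ V →
      (1 - 3 / 4 * b) * (T.leafSum Grad.stretch G W : ℝ)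
        ≤ θ * M * (T.leafSum Grad.sSq G W : ℝ)
          + a * M * ((T.leafSum Grad.sSq G W : ℝ) - (T.leafSum Grad.vortSq G W : ℝ) / 2)
          + b * (T.leafSum Grad.symCubeTrace G W : ℝ)
          + c / M ^ 3 * ((T.leafSum (Grad.sexticU V) G W : ℝ)
              - 1178 * M ^ 6 * (T.leafSum (fun _ => 1) G W : ℝ)) := by
  induction T with
  | leaf =>
      intro G W htr hW hsup
      have hv : (G.vortSq : ℝ) ≤ M ^ 2 := by
        rw [← hV]; exact_mod_cast (show G.vortSq ≤ V by simpa [vortSupFrom] using hsup)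
      have hl := mul_le_mul_of_nonneg_left (h G M hM htr hv) (show (0 : ℝ) ≤ (W : ℝ) by exact_mod_cast hW)
      simp only [leafSum, Grad.sexticU]
      push_cast
      rw [hV]
      linarith
  | node s p m ihp ihm =>
      intro G W htr hW hsup
      obtain ⟨h0, h1, hdot, hp, hm⟩ := valid_node hT
      have htrP : (G.layer (1 - s.lam) s).trace = 0 := by rw [Grad.trace_layer, htr, hdot]; ring
      have htrM : (G.layer (-s.lam) s).trace = 0 := by rw [Grad.trace_layer, htr, hdot]; ring
      have hc := vortSupFrom_children s p m G
      have hP := ihp hp _ (W * s.lam) htrP (mul_nonneg hW h0.le) (hc.1.trans hsup)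
      have hM' := ihm hm _ (W * (1 - s.lam)) htrM (mul_nonneg hW (by linarith)) (hc.2.trans hsup)
      simp only [leafSum]
      push_cast
      linarith

end Tree

/-- **THE (T6) DUAL ASSEMBLY OF THEOREM L-CAP v2**: a pointwise sextic leaf certificate with `c ≥ 0` bounds the
laminate ratio: `LeafClaim6 θ a b c → RatioBound θ`.  Proof verbatim (ap) `ratioBound_of_leafClaim` with the sextic
moment: `Σ W|S_L|² = E`, `Σ W(|S_L|² − ½|ω_L|²) = 0` (I1), `Σ W tr S_L³ = −¾σ` (I2), `Σ W U₆(G_L) ≤ 1178M⁶` (T6),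
`Σ W = 1`; `M(𝒯) = 0` by the Hölder bound of (ad). [ours; elementary] -/
theorem ratioBound_of_leafClaim6 {θ a b c : ℝ} (h : LeafClaim6 θ a b c) (hc : 0 ≤ c) : RatioBound θ := by
  intro T hT
  have hV0 : 0 ≤ T.vortSup := Tree.vortSup_nonneg T hT
  by_cases hz : T.vortSup = 0
  · have hsup : (T.vortSup : ℝ) ≤ (0 : ℝ) ^ 2 := by rw [hz]; simp
    have hh := Tree.abs_sigma_le_holder T hT le_rfl hsup
    have hs : (T.sigma : ℝ) ≤ 0 := by
      have := (abs_le.mp hh).2; simpa using this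
    have : Real.sqrt (T.vortSup : ℝ) = 0 := by rw [hz]; simp
    rw [this]; linarith
  · have hVpos : 0 < T.vortSup := lt_of_le_of_ne hV0 (Ne.symm hz)
    set M : ℝ := Real.sqrt (T.vortSup : ℝ) with hMdef
    have hM : 0 < M := Real.sqrt_pos.mpr (by exact_mod_cast hVpos)
    have hV : ((T.vortSup : ℚ) : ℝ) = M ^ 2 := by
      rw [hMdef, Real.sq_sqrt (by exact_mod_cast hV0)]
    have hsum := Tree.leafClaim6_sum h hM hV T hT Grad.zero 1 Grad.trace_zero zero_le_one
      (show T.vortSupFrom Grad.zero ≤ T.vortSup from le_rfl)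
    have e1 : T.energy = T.leafSum Grad.sSq Grad.zero 1 := Tree.energy_eq_leafSum_sSq T hT
    have e2 := Tree.leafSum_sSq_sub_half_vortSq T hT Grad.zero 1
    rw [Grad.trSq_zero, mul_zero] at e2
    have e3 := Tree.betchov T hT
    have e4 := Tree.sextic_moment T hT (le_refl T.vortSup)
    have e5 := Tree.leafSum_one T Grad.zero 1
    have e6 : T.sigma = T.leafSum Grad.stretch Grad.zero 1 := by
      simp only [Tree.sigma, Tree.stretchFrom_eq_leafSum]
    have e1' : (T.energy : ℝ) = (T.leafSum Grad.sSq Grad.zero 1 : ℝ) := by exact_mod_cast e1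
    have e2' : (T.leafSum Grad.sSq Grad.zero 1 : ℝ) - (T.leafSum Grad.vortSq Grad.zero 1 : ℝ) / 2 = 0 := by
      exact_mod_cast e2
    have e3q : T.leafSum Grad.symCubeTrace Grad.zero 1 = -(3 / 4) * T.sigma := by linarith [e3]
    have e3' : (T.leafSum Grad.symCubeTrace Grad.zero 1 : ℝ) = -(3 / 4) * (T.sigma : ℝ) := by
      rw [e3q]; push_cast; ring
    have e4' : (T.leafSum (Grad.sexticU T.vortSup) Grad.zero 1 : ℝ) ≤ 1178 * M ^ 6 := by
      have h4 : ((T.leafSum (Grad.sexticU T.vortSup) Grad.zero 1 : ℚ) : ℝ)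
          ≤ ((1178 * T.vortSup ^ 3 : ℚ) : ℝ) := by
        exact_mod_cast e4
      push_cast at h4
      rw [hV] at h4
      calc (T.leafSum (Grad.sexticU T.vortSup) Grad.zero 1 : ℝ) ≤ 1178 * (M ^ 2) ^ 3 := h4
        _ = 1178 * M ^ 6 := by ring
    have e5' : (T.leafSum (fun _ => (1 : ℚ)) Grad.zero 1 : ℝ) = 1 := by exact_mod_cast e5
    have e6' : (T.sigma : ℝ) = (T.leafSum Grad.stretch Grad.zero 1 : ℝ) := by exact_mod_cast e6
    have hcM : 0 ≤ c / M ^ 3 := div_nonneg hc (pow_nonneg hM.le 3)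
    have hlast : c / M ^ 3 * ((T.leafSum (Grad.sexticU T.vortSup) Grad.zero 1 : ℝ)
        - 1178 * M ^ 6 * (T.leafSum (fun _ => (1 : ℚ)) Grad.zero 1 : ℝ)) ≤ 0 := by
      rw [e5', mul_one]
      have := mul_nonneg hcM (show (0 : ℝ) ≤ 1178 * M ^ 6 - (T.leafSum (Grad.sexticU T.vortSup) Grad.zero 1 : ℝ)
        by linarith)
      linarith
    rw [e2', e3', ← e1', ← e6'] at hsum
    linarith [hsum, hlast]

/-- `LeafClaim6 θ a b c → 0 ≤ c → laminateSupConst ≤ θ`. [ours; elementary] -/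
theorem laminateSupConst_le_of_leafClaim6 {θ a b c : ℝ} (h : LeafClaim6 θ a b c) (hc : 0 ≤ c) :
    laminateSupConst ≤ θ :=
  laminateSupConst_le_of_ratioBound (ratioBound_of_leafClaim6 h hc)

end Laminate

end Summit.NavierStokesRegularity.FunctionalMining
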